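import Summits.Ventures.Crystal3D.Theorems.StickyWulffConstantNoReconstructionGainExactDefs
import Summits.Ventures.Crystal3D.Theorems.StickyWulffConstantNoReconstructionGainLatticeAdhesion
import HarnessLib

/-!
# Fractional orientation certificates (line `replication-exactness`, a licence for certificate designers)

HONEST FRAMING. Part of the venture `Summits/Ventures/Crystal3D` (cell `crystal3d-full`), helper `--supports` the
crux `NoReconstructionGain` (stmt-Ventures-19144, route `route-Ventures-StickyWulffConstant`), lead wulff-p1 g19.  The
landed Hakimi equivalence `stub_certificate_iff` (`ExactZeroGain ↔ OrientationCertificate`) speaks of INTEGRAL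
orientations of the film's contact graph, globally; here is the per-film, REAL-VALUED form of the easy direction:
a fractional splitting `y q' q + y q q' = 1` of every film bond with `Σ_{q' ∼ q} y q' q + plug q ≤ 6` at every ball
already forces `X(H,Q) ≤ D(Q)` (sum over the balls; each bond contributes exactly `1`), hence `Q` is not a criminal.
Why record it: every CONVEX COMBINATION of acyclic (potential) certificates is such a `y` — e.g. averaging the
height orientations over several directions `e₁,…,eₘ` (ties split `½`) — and these mixtures are not potential
certificates themselves (`adhesion_of_realCertificate` is the single-potential case, `f`-order).

* `two_mul_sum_frac_eq_orderedContacts` — `2 · Σ_q Σ_{q'∼q} y q' q = orderedContacts Q` when `y + yᵀ = 1` on bonds;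
* `plugCount_le_of_fracOrientation` — the fractional certificate gives `X(H,Q) ≤ D(Q)`;
* `not_isCriminal_of_fracOrientation` — hence no criminal carries one.

WHAT THIS IS NOT: no certificate is constructed here for any class of films; rung F-C1 not moved.
-/

noncomputable section

namespace Summit.Ventures.Crystal3D.Theorems

open Summit.Ventures.Crystal3D Finset
open Literature.MathematicalPhysics.StatisticalMechanics (fccStacking contactDeficiency orderedContacts)
open scoped InnerProductSpace

/-- If `y q' q + y q q' = 1` on every bond of `Q`, then `2 · Σ_{q ∈ Q} Σ_{q' ∈ Q, q' ∼ q} y q' q = orderedContacts Q`. -/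
theorem two_mul_sum_frac_eq_orderedContacts (Q : Finset (EuclideanSpace ℝ (Fin 3)))
    (y : EuclideanSpace ℝ (Fin 3) → EuclideanSpace ℝ (Fin 3) → ℝ)
    (hy : ∀ q ∈ Q, ∀ q' ∈ Q, dist q q' = 1 → y q q' + y q' q = 1) :
    2 * ∑ q ∈ Q, ∑ q' ∈ Q.filter (fun q' => dist q q' = 1), y q' q = (orderedContacts Q : ℝ) := by
  classical
  -- write both as sums over `Q × Q` with an indicator
  have h1 : ∑ q ∈ Q, ∑ q' ∈ Q.filter (fun q' => dist q q' = 1), y q' q =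
      ∑ q ∈ Q, ∑ q' ∈ Q, (if dist q q' = 1 then y q' q else 0) := by
    refine Finset.sum_congr rfl fun q _ => ?_
    rw [Finset.sum_filter]
  have h2 : ∑ q ∈ Q, ∑ q' ∈ Q, (if dist q q' = 1 then y q' q else 0) =
      ∑ q ∈ Q, ∑ q' ∈ Q, (if dist q q' = 1 then y q q' else 0) := by
    rw [Finset.sum_comm]
    refine Finset.sum_congr rfl fun q _ => Finset.sum_congr rfl fun q' _ => ?_
    rw [dist_comm]
  have h3 : ∑ q ∈ Q, ∑ q' ∈ Q, (if dist q q' = 1 then y q' q else 0) +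
      ∑ q ∈ Q, ∑ q' ∈ Q, (if dist q q' = 1 then y q q' else 0) =
      ∑ q ∈ Q, ∑ q' ∈ Q, (if dist q q' = 1 then (1 : ℝ) else 0) := by
    rw [← Finset.sum_add_distrib]
    refine Finset.sum_congr rfl fun q hq => ?_
    rw [← Finset.sum_add_distrib]
    refine Finset.sum_congr rfl fun q' hq' => ?_
    split_ifs with h
    · rw [add_comm]; exact hy q hq q' hq' h
    · simp
  rw [two_mul]
  nth_rw 1 [h1]
  rw [h1]
  nth_rw 2 [h2]
  rw [h3, ← orderedContacts_eq_sum_sum]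

/-- **A fractional orientation certificate forces `X(H,Q) ≤ D(Q)`.** -/
theorem plugCount_le_of_fracOrientation {ν : EuclideanSpace ℝ (Fin 3)} {s : ℝ}
    (Q : Finset (EuclideanSpace ℝ (Fin 3))) (y : EuclideanSpace ℝ (Fin 3) → EuclideanSpace ℝ (Fin 3) → ℝ)
    (hy : ∀ q ∈ Q, ∀ q' ∈ Q, dist q q' = 1 → y q q' + y q' q = 1)
    (hcap : ∀ q ∈ Q, ∑ q' ∈ Q.filter (fun q' => dist q q' = 1), y q' q + ((plugSet ν s q).ncard : ℝ) ≤ 6) :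
    (plugCount ν s Q : ℝ) ≤ contactDeficiency Q := by
  classical
  have hsum := Finset.sum_le_sum hcap
  rw [Finset.sum_add_distrib, Finset.sum_const, nsmul_eq_mul] at hsum
  have h2 := two_mul_sum_frac_eq_orderedContacts Q y hy
  have hD : contactDeficiency Q = 6 * (Q.card : ℝ) - (orderedContacts Q : ℝ) / 2 := rfl
  have hP : (plugCount ν s Q : ℝ) = ∑ q ∈ Q, ((plugSet ν s q).ncard : ℝ) := by
    unfold plugCount; push_cast; rfl
  rw [hD, hP]
  linarith

/-- **No criminal carries a fractional orientation certificate.** -/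
theorem not_isCriminal_of_fracOrientation {ν : EuclideanSpace ℝ (Fin 3)} {s : ℝ}
    {Q : Finset (EuclideanSpace ℝ (Fin 3))} (y : EuclideanSpace ℝ (Fin 3) → EuclideanSpace ℝ (Fin 3) → ℝ)
    (hy : ∀ q ∈ Q, ∀ q' ∈ Q, dist q q' = 1 → y q q' + y q' q = 1)
    (hcap : ∀ q ∈ Q, ∑ q' ∈ Q.filter (fun q' => dist q q' = 1), y q' q + ((plugSet ν s q).ncard : ℝ) ≤ 6) :
    ¬ IsCriminal ν s Q := by
  classical
  rintro ⟨-, hne, hcore⟩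
  have h1 := hcore Q (Finset.Subset.refl Q) hne
  simp only [Finset.sdiff_self, Finset.empty_product, Finset.filter_empty, Finset.card_empty,
    Nat.cast_zero, add_zero] at h1
  have h2 := plugCount_le_of_fracOrientation Q y hy hcap
  linarith

end Summit.Ventures.Crystal3D.Theorems

end
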